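import Summits.QuantumFields.BalabanUV.T4Continuum.Support.B13OpDatum
import Literature.MathematicalPhysics.QuantumFieldTheory.Balaban1983to89.T4OperatorRateLiaison
import Summits.QuantumFields.BalabanUV.T4Continuum.Support.ActivityTermReadouts

/-!
# B13OpDatumJunctions — row O1-b part 2 of 2: the step's operator-data maps from raw species suppliers, the junction to row
# NE2's ENTRYWISE currency (⇒ the liaison's `AbsOperatorRate` ⇒ W1 `StepModel.OperatorRate`), and the junction to route P2
# (a term's five operator read-outs ARE coordinate read-outs of the datum, `Calibrated` with moduli `1`)

Cell `pub-balaban`, unit `b2b-balaban-t4-ne5-formalise-leaf-07` (NE5 formalisation swarm, LEAF PROVER 07; row **O1-b OPERATOR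
DATUM** of `t4/b2b-balaban-t4-ne5-p1/O1-CLAIM-TABLE-NE5-P1.md`; part 1 = `Support/B13OpDatum`).  Summits-side NEW WORK under
the LEAN PLACEMENT RULE (modelling + bookkeeping; print cited for KIND only).  HONEST FRAMING: rung (B)+1 of the FINITE-VOLUME T⁴
continuum programme — NOT infinite volume, NOT a mass gap, NOT the Clay problem, NOT a proof of NE5 (NOT PRINTED: the series
prints ε-UNIFORM bounds, never η-RATES).  HONEST DEPENDENCY (cell, verbatim): continuum YM on T⁴ ⇐ BetaPertH ∧ nine spine
estimates (0/9 proved); BetaPertH ⇐ (D1) ∧ (D4) ∧ CAP+tail; G-an2-4 gates asym, D1 and NE2/3/4.  NO estimate about Bałaban's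
objects is asserted: every `def` is data or a hypothesis SHAPE, every theorem is bookkeeping (0 sorry).

§1 DATA MAPS.  `opOf F raw g U k := assemble (F k) (raw g U k)` — the shape of `StepModel.opA`∕`opB` on `Op = OpDatum E` from
per-step formats `F k` and a RAW SUPPLIER `raw : (ℕ → ℝ) → Bg → ℕ → E → ℂ` (for B13: `RawSpecies.kernel` of part 1).  THE
SUPPLIERS ARE THE NAMED PARAMETERS of an instantiation: the tree holds two-run objects only for the covariance species at
`U = 1` (row NE2's unit layer ∕ tower values); plugging them in is row O4-r's READING, not done here.  `RawBounded` (one-run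
format bounds on the window — printed KIND) and **`WeightedEntrywiseRate F rawA rawB W c rate`** (NOT PRINTED; row NE2's two-run
object in ENTRY currency — the shape of `T4EtaRate.EtaRateIneqUnit`, `|Kd(y,y′)| ≤ B₀·e^{−δ₀d(y,y′)}·θ^k`) give
`‖opOf F rawA g U k − opOf F rawB g U k‖ ≤ c·rate k` (`norm_opOf_sub_le`), hence for any `StepModel` whose operator data ARE
`opOf` the liaison's `AbsOperatorRate M W c θ` (`absRate_of_weightedEntrywise`) and, with an [I]-type margin floor, W1
`StepModel.OperatorRate W (c ∕ r₀) θ` by the liaison's `operatorRate_of_absRate_floor` BY NAME (`operatorRate_of_weightedEntrywise_floor`).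

§2 ROUTE P2.  `readouts F t : LinearReadouts (OpDatum (Species T κ ι Ω 𝒴)) ι κ Ω 𝒴` — at slot `t`, `LL ↦ gammaConstituent`,
`LA ↦ deltaKer`, `LP ↦ cov`, `LQ ↦ potQ`, `LR ↦ potR`, each the coordinate read-out `entryCLM`; `calibrated_readouts_of_dominated`
(format weights dominated by the term's entry formats ⇒ `Calibrated 𝔱 𝔠 λL λA λP λQ λR`) and `calibrated_readouts_b13`
(`B13Weights.format` of the term's own letters ⇒ `Calibrated 𝔱 𝔠 1 1 1 1 1`); `readouts_assemble` (read-outs of an assembled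
raw-species record return the raw kernels).  So ONE datum serves `StepModel.Out` (route P1, row O1-d) and `TermFamily` (P2):
P2's `readLip_of_linear` then gives `ReadLip` from `Reads` (row O1-d defines the term's `kL kA kP kQ kR` AS these read-outs).

WHICH ROW-NE2 CURRENCY FITS (an interface finding, not an estimate).  The weighted ENTRY format is what B13 (2.16)∕(1.43) print
and what `Calibrated` needs (`‖LP a′ a″‖ ≤ λP·e^{−δd(q a′, q a″)}` cannot come from an operator-norm-typed block with a
volume-independent `λP`).  Its K-uniform two-run supplier is row NE2's ENTRYWISE layer (`EtaRateIneqUnit`∕`NE2PlusUnit`) through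
`WeightedEntrywiseRate` — NOT the operator-norm tower socket `OutputRateTowerSocket.ReadsTower`: an `ℓ²`-operator-norm increment
bounds each entry uniformly and packages into a decaying-weight format only with the loss `1 ∕ min wt` (part 1's
`norm_assemble_sub_le_of_uniform`), which grows with the unit torus.  A species that row O4-r wants to read from a tower
DEFINITIONALLY should get a constant-weight format on its block (then `cR = 1 ∕ wt`), at the price of P2's calibration for it;
the choice per species is O4-r's.  Imported BY NAME, unmodified: `StepModel` (+ `OperatorRate`), `AbsOperatorRate`,
`operatorRate_of_absRate_floor`, `LinearReadouts` (+ `Calibrated`), `TermDatum`, `TermConsts`.  `FlowStep.BetaPertH`, (B), (B^μ)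
do not occur.
-/

noncomputable section

open scoped BigOperators ENNReal

namespace Summit.QuantumFields.BalabanUV.T4Continuum.B13OpDatumJunctions

open Summit.QuantumFields.BalabanUV.T4Continuum.B13OpDatum
open Literature.MathematicalPhysics.QuantumFieldTheory.Balaban1983to89.T4OutputRate (Carriers)
open Literature.MathematicalPhysics.QuantumFieldTheory.Balaban1983to89.T4InputCauchyRateData (StepModel)
open Literature.MathematicalPhysics.QuantumFieldTheory.Balaban1983to89.T4OperatorRateLiaison
  (AbsOperatorRate operatorRate_of_absRate_floor)
open Summit.QuantumFields.BalabanUV.T4Continuum.ActivityTermModel (TermDatum TermConsts)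
open Summit.QuantumFields.BalabanUV.T4Continuum.ActivityTermReadouts (LinearReadouts)

/-! ## §1 The step's operator-data maps from RAW SPECIES SUPPLIERS, and the junction to row NE2's entrywise currency -/

section DataMaps

variable {E Bg : Type*}

/-- THE STEP'S OPERATOR-DATA MAP of one run from per-step formats `F k` and a raw supplier `raw g U k : E → ℂ` (coupling
sequence `g`, background datum `U`, step `k`): `opOf F raw g U k = assemble (F k) (raw g U k)` — the shape of
`StepModel.opA`∕`opB` with `Op = OpDatum E`. [folklore] -/
def opOf (F : ℕ → Format E) (raw : (ℕ → ℝ) → Bg → ℕ → E → ℂ) : (ℕ → ℝ) → Bg → ℕ → OpDatum E :=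
  fun g U k => assemble (F k) (raw g U k)

/-- [folklore] `opOf` unfolds. -/
@[simp] theorem opOf_apply (F : ℕ → Format E) (raw : (ℕ → ℝ) → Bg → ℕ → E → ℂ) (g : ℕ → ℝ) (U : Bg) (k : ℕ) :
    opOf F raw g U k = assemble (F k) (raw g U k) := rfl

/-- HYPOTHESIS SHAPE (one run's raw species are format-bounded on the window — printed KIND for one run, (1.7)∕(2.16)∕(1.43)∕
(1.36); asserted nowhere). [folklore] -/
def RawBounded (F : ℕ → Format E) (raw : (ℕ → ℝ) → Bg → ℕ → E → ℂ) (W : Set (ℕ → ℝ)) : Prop :=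
  ∀ k, ∀ g ∈ W, ∀ U : Bg, FormatBounded (F k) (raw g U k)

/-- HYPOTHESIS SHAPE **`WeightedEntrywiseRate`** (NOT PRINTED — row NE2's two-run object in ENTRY currency: the shape of
`T4EtaRate.EtaRateIneqUnit` (`|Kd(y, y′)| ≤ B₀·e^{−δ₀d(y,y′)}·θ^k`: `c = B₀`, `rate k = θ^k`, `wt = e^{−δ₀d}`) ∕ of the liaison's
`EntrywiseRate`, here against arbitrary format weights and for an arbitrary entry set; asserted nowhere): at step `k` every raw
entry of the two runs differs by at most `c · rate k · wt e`. [folklore] -/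
def WeightedEntrywiseRate (F : ℕ → Format E) (rawA rawB : (ℕ → ℝ) → Bg → ℕ → E → ℂ) (W : Set (ℕ → ℝ)) (c : ℝ)
    (rate : ℕ → ℝ) : Prop :=
  ∀ k, ∀ g ∈ W, ∀ (U : Bg) (e : E), ‖rawA g U k e - rawB g U k e‖ ≤ c * rate k * (F k).wt e

/-- [folklore] **ENTRY CURRENCY ⇒ NORM CURRENCY** for the data maps: bounded raw suppliers with a weighted entrywise rate
`c·rate k` give `‖opOf F rawA g U k − opOf F rawB g U k‖ ≤ c·rate k`. -/
theorem norm_opOf_sub_le {F : ℕ → Format E} {rawA rawB : (ℕ → ℝ) → Bg → ℕ → E → ℂ} {W : Set (ℕ → ℝ)} {c : ℝ}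
    {rate : ℕ → ℝ} (hA : RawBounded F rawA W) (hB : RawBounded F rawB W) (h : WeightedEntrywiseRate F rawA rawB W c rate)
    (hc : 0 ≤ c) (hrate : ∀ k, 0 ≤ rate k) (k : ℕ) {g : ℕ → ℝ} (hg : g ∈ W) (U : Bg) :
    ‖opOf F rawA g U k - opOf F rawB g U k‖ ≤ c * rate k :=
  norm_assemble_sub_le (hA k g hg U) (hB k g hg U) (mul_nonneg hc (hrate k)) (h k g hg U)

/-- HYPOTHESIS SHAPE **`LevelEntryRate`** (NOT PRINTED; the CONSECUTIVE-LEVEL form in which row NE2's suppliers are stated —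
`T4EtaRate.EtaRateIneqUnit` at `k` levels, `T4EtaRateMin.LocalRate`'s `|loc (k+1) − loc k|`, the tower increment
`avgTow (k+1) − avgTow k`): ONE family of raw kernels `ker g U n` indexed by the number `n` of fine levels below the common unit
lattice, whose consecutive members differ entrywise by at most `c · rate k · wt e`. [folklore] -/
def LevelEntryRate (F : ℕ → Format E) (ker : (ℕ → ℝ) → Bg → ℕ → E → ℂ) (W : Set (ℕ → ℝ)) (c : ℝ) (rate : ℕ → ℝ) : Prop :=
  ∀ k, ∀ g ∈ W, ∀ (U : Bg) (e : E), ‖ker g U k e - ker g U (k + 1) e‖ ≤ c * rate k * (F k).wt e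

/-- [folklore] THE TWO RUNS AS TWO CONSECUTIVE LEVELS OF ONE FAMILY: run A at step `k` reads `ker g U k` (`k` fine levels under
the common unit lattice), run B at the paired step reads `ker g U (k + 1)`; a consecutive-level entry rate IS a weighted entrywise
rate for this pair of suppliers. -/
theorem weightedEntrywiseRate_of_levels {F : ℕ → Format E} {ker : (ℕ → ℝ) → Bg → ℕ → E → ℂ} {W : Set (ℕ → ℝ)} {c : ℝ}
    {rate : ℕ → ℝ} (h : LevelEntryRate F ker W c rate) :
    WeightedEntrywiseRate F ker (fun g U k => ker g U (k + 1)) W c rate :=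
  fun k g hg U e => h k g hg U e

variable {C : Carriers} {Hist : Type*} [NormedAddCommGroup Hist] [NormedSpace ℂ Hist]

/-- [folklore] **JUNCTION TO ROW NE2's CURRENCY (liaison (L1) for the weighted datum)**: a step model on `Op = OpDatum E` whose
operator data ARE `opOf F rawA`∕`opOf F rawB` (row O1-b's typing), with bounded raw suppliers and a weighted entrywise rate
`c·θ^k`, satisfies the liaison's `AbsOperatorRate M W c θ`. -/
theorem absRate_of_weightedEntrywise (M : StepModel C (OpDatum E) Hist) {F : ℕ → Format E}
    {rawA rawB : (ℕ → ℝ) → C.BgB → ℕ → E → ℂ} {W : Set (ℕ → ℝ)} {c θ : ℝ} (hopA : M.opA = opOf F rawA)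
    (hopB : M.opB = opOf F rawB) (hA : RawBounded F rawA W) (hB : RawBounded F rawB W)
    (h : WeightedEntrywiseRate F rawA rawB W c (fun k => θ ^ k)) (hc : 0 ≤ c) (hθ : 0 ≤ θ) : AbsOperatorRate M W c θ := by
  intro k g hg U
  rw [hopA, hopB]
  exact norm_opOf_sub_le hA hB h hc (fun k => pow_nonneg hθ k) k hg U

/-- [folklore] **… AND TO W1 IN MARGIN UNITS** (the liaison's `operatorRate_of_absRate_floor` BY NAME): with an [I]-type margin
floor `r₀ ≤ rOp k`, the weighted entrywise rate gives `StepModel.OperatorRate W (c ∕ r₀) θ`. -/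
theorem operatorRate_of_weightedEntrywise_floor (M : StepModel C (OpDatum E) Hist) {F : ℕ → Format E}
    {rawA rawB : (ℕ → ℝ) → C.BgB → ℕ → E → ℂ} {W : Set (ℕ → ℝ)} {c θ r₀ : ℝ} (hopA : M.opA = opOf F rawA)
    (hopB : M.opB = opOf F rawB) (hA : RawBounded F rawA W) (hB : RawBounded F rawB W)
    (h : WeightedEntrywiseRate F rawA rawB W c (fun k => θ ^ k)) (hc : 0 ≤ c) (hθ : 0 ≤ θ) (hfl : ∀ k, r₀ ≤ M.rOp k)
    (hr₀ : 0 < r₀) : M.OperatorRate W (c / r₀) θ :=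
  operatorRate_of_absRate_floor M (absRate_of_weightedEntrywise M hopA hopB hA hB h hc hθ) hfl hr₀ hc hθ

end DataMaps

/-! ## §2 The junction to route P2: a term's five operator read-outs ARE coordinate read-outs, calibrated with moduli `1` -/

section Readouts

variable {T κ ι S Ω Ω₀ 𝒴 𝒞 Hist : Type*}

/-- THE READ-OUTS OF A TERM AT SLOT `t` as P2's `LinearReadouts` of the datum: `LL ↦ gammaConstituent`, `LA ↦ deltaKer`,
`LP ↦ cov` (all at slot `t`), `LQ ↦ potQ`, `LR ↦ potR` — coordinate read-outs `entryCLM`. [folklore] -/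
def readouts (F : Format (Species T κ ι Ω 𝒴)) (t : T) : LinearReadouts (OpDatum (Species T κ ι Ω 𝒴)) ι κ Ω 𝒴 where
  LL a' i := entryCLM F (.gammaConstituent t a' i)
  LA i j := entryCLM F (.deltaKer t i j)
  LP a' a'' := entryCLM F (.cov t a' a'')
  LQ x Y b b' := entryCLM F (.potQ x Y b b')
  LR x Y := entryCLM F (.potR x Y)

/-- [folklore] **`Calibrated` FROM FORMAT DOMINATION**: if the format weights at slot `t` are dominated by the term's entry
formats (`wt (gammaConstituent t a′ i) ≤ λL e^{−2δ d(q a′, p i)}`, …, `|τ Y|·wt (potQ x Y b b′) ≤ λQ w(Y)k(b, b′)` on the term's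
domains and bonds, `|τ Y|·wt (potR x Y) ≤ λR v(Y)`), the coordinate read-outs are `Calibrated 𝔱 𝔠 λL λA λP λQ λR`. -/
theorem calibrated_readouts_of_dominated [MeasurableSpace Ω] [MeasurableSpace Ω₀] (F : Format (Species T κ ι Ω 𝒴)) (t : T)
    (𝔱 : TermDatum (OpDatum (Species T κ ι Ω 𝒴)) Hist ι κ S Ω Ω₀ 𝒴 𝒞) (𝔠 : TermConsts) {lamL lamA lamP lamQ lamR : ℝ}
    (hL : ∀ a' i, F.wt (.gammaConstituent t a' i) ≤ lamL * Real.exp (-(2 * 𝔠.δ * 𝔱.d (𝔱.q a') (𝔱.p i))))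
    (hA : ∀ i j, F.wt (.deltaKer t i j) ≤ lamA * Real.exp (-(2 * 𝔠.δ * 𝔱.d (𝔱.p i) (𝔱.p j))))
    (hP : ∀ a' a'', F.wt (.cov t a' a'') ≤ lamP * Real.exp (-(𝔠.δ * 𝔱.d (𝔱.q a') (𝔱.q a''))))
    (hQ : ∀ x, ∀ Y ∈ 𝔱.D, ∀ b ∈ 𝔱.bonds Y, ∀ b' ∈ 𝔱.bonds Y, ‖𝔱.τ Y‖ * F.wt (.potQ x Y b b') ≤ lamQ * (𝔱.w Y * 𝔱.kk b b'))
    (hR : ∀ x, ∀ Y ∈ 𝔱.D, ‖𝔱.τ Y‖ * F.wt (.potR x Y) ≤ lamR * 𝔱.v Y) :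
    (readouts F t).Calibrated 𝔱 𝔠 lamL lamA lamP lamQ lamR where
  hL a' i := (norm_entryCLM_le F _).trans (hL a' i)
  hA i j := (norm_entryCLM_le F _).trans (hA i j)
  hP a' a'' := (norm_entryCLM_le F _).trans (hP a' a'')
  hQ x Y hY b hb b' hb' :=
    (mul_le_mul_of_nonneg_left (norm_entryCLM_le F _) (norm_nonneg _)).trans (hQ x Y hY b hb b' hb')
  hR x Y hY := (mul_le_mul_of_nonneg_left (norm_entryCLM_le F _) (norm_nonneg _)).trans (hR x Y hY)

/-- [folklore] **`Calibrated` WITH ALL MODULI `1` FOR THE B13 FORMAT OF THE TERM'S OWN GEOMETRY**: if the weights are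
`B13Weights.format G` with `G`'s letters equal to the term's (`d, p, q, τ, w, kk, v`) and `G.δ = 𝔠.δ`, then
`(readouts G.format t).Calibrated 𝔱 𝔠 1 1 1 1 1` — no estimate, a normalisation. -/
theorem calibrated_readouts_b13 [MeasurableSpace Ω] [MeasurableSpace Ω₀] (G : B13Weights κ ι S 𝒴) (t : T)
    (𝔱 : TermDatum (OpDatum (Species T κ ι Ω 𝒴)) Hist ι κ S Ω Ω₀ 𝒴 𝒞) (𝔠 : TermConsts) (hd : G.d = 𝔱.d) (hp : G.p = 𝔱.p)
    (hq : G.q = 𝔱.q) (hδ : G.δ = 𝔠.δ) (hτ : G.τ = 𝔱.τ) (hw : G.w = 𝔱.w) (hkk : G.kk = 𝔱.kk) (hv : G.v = 𝔱.v) :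
    (readouts (G.format (T := T) (Ω := Ω)) t).Calibrated 𝔱 𝔠 1 1 1 1 1 := by
  refine calibrated_readouts_of_dominated _ t 𝔱 𝔠 ?_ ?_ ?_ ?_ ?_
  · intro a' i; rw [B13Weights.format_wt, B13Weights.wt, hd, hq, hp, hδ, one_mul]
  · intro i j; rw [B13Weights.format_wt, B13Weights.wt, hd, hp, hδ, one_mul]
  · intro a' a''; rw [B13Weights.format_wt, B13Weights.wt, hd, hq, hδ, one_mul]
  · intro x Y _ b _ b' _
    have hτY : ‖𝔱.τ Y‖ ≠ 0 := by rw [← hτ]; exact norm_ne_zero_iff.2 (G.τ_ne Y)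
    rw [B13Weights.format_wt, B13Weights.wt, hτ, hw, hkk, one_mul, mul_div_cancel₀ _ hτY]
  · intro x Y _
    have hτY : ‖𝔱.τ Y‖ ≠ 0 := by rw [← hτ]; exact norm_ne_zero_iff.2 (G.τ_ne Y)
    rw [B13Weights.format_wt, B13Weights.wt, hτ, hv, one_mul, mul_div_cancel₀ _ hτY]

/-- [folklore] Reading the raw species back: at a datum assembled from a format-bounded raw-species record, the term's
read-outs return the raw kernels (`LP a′ a″ ↦ r.cov t a′ a″`, etc.). -/
theorem readouts_assemble (F : Format (Species T κ ι Ω 𝒴)) (t : T) {r : RawSpecies T κ ι Ω 𝒴}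
    (h : FormatBounded F r.kernel) :
    (∀ a' a'', (readouts F t).LP a' a'' (assemble F r.kernel) = r.cov t a' a'') ∧
      (∀ i j, (readouts F t).LA i j (assemble F r.kernel) = r.deltaKer t i j) ∧
      (∀ a' i, (readouts F t).LL a' i (assemble F r.kernel) = r.gammaConstituent t a' i) ∧
      (∀ x Y b b', (readouts F t).LQ x Y b b' (assemble F r.kernel) = r.potQ x Y b b') ∧
      (∀ x Y, (readouts F t).LR x Y (assemble F r.kernel) = r.potR x Y) :=
  ⟨fun _ _ => entryCLM_assemble h _, fun _ _ => entryCLM_assemble h _, fun _ _ => entryCLM_assemble h _,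
    fun _ _ _ _ => entryCLM_assemble h _, fun _ _ => entryCLM_assemble h _⟩

end Readouts

end Summit.QuantumFields.BalabanUV.T4Continuum.B13OpDatumJunctions
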